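import Mathlib

/-!
# Formal coordinate changes of `k[[x₁,…,xₙ]]`: injectivity and `𝔪²`

Folklore infrastructure about `MvPowerSeries.subst` over a field `k`, written for the local
resolution game on formal hypersurface germs (weighted / cobordant blow-ups, Włodarczyk
arXiv:2203.03090 §4; Abramovich–Quek–Schober arXiv:2412.16426 §5–6), where a move starts with
a formal coordinate change `θ = (θ₁,…,θₙ)`, `θᵢ ∈ 𝔪`, with invertible linear part:

* `two_le_order_iff` — `f ∈ 𝔪²` (no constant, no linear coefficients) iff `2 ≤ order f`;
* `two_le_order_subst` — a substitution `θ` with `θ i ∈ 𝔪` maps `𝔪²` into `𝔪²`;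
* `subst_ne_zero_of_isUnit_det` — a substitution `θ` with `θ i ∈ 𝔪` and invertible linear part
  (`IsUnit (linMat θ).det`) kills no nonzero series, i.e. the formal coordinate change is
  INJECTIVE on `k[[x]]`.  Proof: normalise by `L⁻¹` (`normalize`, `subst_eq_subst_normalize`);
  a tangent-to-identity substitution does not change the coefficients of lowest degree
  (`TangentId.coeff_subst_of_degree_le`, via the bookkeeping predicate
  `MonPlus P d : P = Xᵈ + (order > |d|)`); an invertible LINEAR substitution has a two-sided
  inverse (`subst_linSubst_injective`).

Deliberately NOT here: surjectivity / the formal inverse function theorem (not needed for the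
game), and the equality `order (subst θ f) = order f` (only `≠ 0` and the lower bound are used).
-/

open MvPowerSeries

namespace Literature.AlgebraicGeometry.Resolution.FormalCoordChange

variable {σ : Type*} {k : Type*} [Field k]

/-- `X s ≠ 0` over a nontrivial coefficient ring. [folklore] -/
theorem X_ne_zero' {σ R : Type*} [Semiring R] [Nontrivial R] (s : σ) :
    (MvPowerSeries.X s : MvPowerSeries σ R) ≠ 0 := by
  intro h
  have := congrArg (MvPowerSeries.coeff (Finsupp.single s 1)) h
  simp [MvPowerSeries.coeff_index_single_self_X] at this

variable {σ : Type*} {k : Type*} [Field k]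


/-! ### degree-`< 2` exponents -/

/-- An exponent vector of degree `< 2` is `0` or a unit vector `single i 1`. [folklore] -/
theorem eq_zero_or_single_of_degree_lt_two (d : σ →₀ ℕ) (h : d.degree < 2) :
    d = 0 ∨ ∃ i, d = Finsupp.single i 1 := by
  classical
  by_cases hd : d = 0
  · exact Or.inl hd
  right
  obtain ⟨i, hi⟩ : ∃ i, d i ≠ 0 := by
    by_contra hcon
    push Not at hcon
    exact hd (Finsupp.ext hcon)
  have hi1 : d i = 1 := by
    have := Finsupp.le_degree i d
    omega
  refine ⟨i, ?_⟩
  have hsplit : d = Finsupp.single i 1 + (d - Finsupp.single i 1) := by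
    ext j
    by_cases hj : j = i
    · subst hj; simp [hi1]
    · simp [Ne.symm hj]
  have hdeg : (d - Finsupp.single i 1).degree = 0 := by
    have := congrArg Finsupp.degree hsplit
    rw [map_add, Finsupp.degree_single] at this
    omega
  rw [Finsupp.degree_eq_zero_iff] at hdeg
  rw [hsplit, hdeg, add_zero]

/-- `f ∈ 𝔪²` (no constant and no linear terms) iff `2 ≤ order f`. [folklore] -/
theorem two_le_order_iff (f : MvPowerSeries σ k) :
    2 ≤ f.order ↔ MvPowerSeries.constantCoeff f = 0 ∧
      ∀ i, MvPowerSeries.coeff (Finsupp.single i 1) f = 0 := by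
  constructor
  · intro h
    refine ⟨?_, fun i => ?_⟩
    · rw [← MvPowerSeries.coeff_zero_eq_constantCoeff_apply]
      apply MvPowerSeries.coeff_of_lt_order
      exact lt_of_lt_of_le (by simp) h
    · apply MvPowerSeries.coeff_of_lt_order
      exact lt_of_lt_of_le (by simp) h
  · rintro ⟨h0, h1⟩
    apply MvPowerSeries.nat_le_order
    intro d hd
    rcases eq_zero_or_single_of_degree_lt_two d (by exact_mod_cast hd) with rfl | ⟨i, rfl⟩
    · simpa using h0
    · exact h1 i

/-! ### substitution preserves `𝔪²` -/

/-- A substitution whose components have zero constant term maps `𝔪²` into `𝔪²`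
(`2 ≤ order f → 2 ≤ order (subst θ f)`), via `MvPowerSeries.le_order_subst`. [folklore] -/
theorem two_le_order_subst {n : ℕ} {τ : Type*} (θ : Fin n → MvPowerSeries τ k)
    (hθ : ∀ i, MvPowerSeries.constantCoeff (θ i) = 0) (f : MvPowerSeries (Fin n) k)
    (hf : 2 ≤ f.order) : 2 ≤ (MvPowerSeries.subst θ f).order := by
  have h1 : (1 : ℕ∞) ≤ ⨅ i, (θ i).order :=
    le_iInf fun i => (MvPowerSeries.one_le_order_iff_constCoeff_eq_zero).mpr (hθ i)
  calc (2 : ℕ∞) = 1 * 2 := by norm_num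
    _ ≤ (⨅ i, (θ i).order) * f.order := mul_le_mul' h1 hf
    _ ≤ _ := MvPowerSeries.le_order_subst (MvPowerSeries.hasSubst_of_constantCoeff_zero hθ) f

/-! ### `monomial d 1 +` higher order -/

/-- `P = X^d + (terms of order > |d|)`. [folklore] -/
def MonPlus (P : MvPowerSeries σ k) (d : σ →₀ ℕ) : Prop :=
  ∃ H : MvPowerSeries σ k, P = MvPowerSeries.monomial d 1 + H ∧ (d.degree : ℕ∞) < H.order

/-- `1 = X⁰ + 0`. [folklore] -/
theorem monPlus_one : MonPlus (1 : MvPowerSeries σ k) 0 :=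
  ⟨0, by simp [MvPowerSeries.monomial_zero_one], by simp⟩

/-- `MonPlus` is multiplicative: `(Xᵃ + h.o.t.)(Xᵇ + h.o.t.) = Xᵃ⁺ᵇ + h.o.t.`. [folklore] -/
theorem monPlus_mul {P Q : MvPowerSeries σ k} {a b : σ →₀ ℕ} (hP : MonPlus P a) (hQ : MonPlus Q b) :
    MonPlus (P * Q) (a + b) := by
  obtain ⟨H₁, rfl, h₁⟩ := hP
  obtain ⟨H₂, rfl, h₂⟩ := hQ
  refine ⟨MvPowerSeries.monomial a 1 * H₂ + (H₁ * MvPowerSeries.monomial b 1 + H₁ * H₂), ?_, ?_⟩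
  · have hm : MvPowerSeries.monomial a (1 : k) * MvPowerSeries.monomial b 1 =
        MvPowerSeries.monomial (a + b) 1 := by
      rw [MvPowerSeries.monomial_mul_monomial, one_mul]
    rw [← hm]; ring
  · have ha : (MvPowerSeries.monomial a (1 : k)).order = a.degree :=
      MvPowerSeries.order_monomial_of_ne_zero one_ne_zero
    have hb : (MvPowerSeries.monomial b (1 : k)).order = b.degree :=
      MvPowerSeries.order_monomial_of_ne_zero one_ne_zero
    have e1 : ((a + b).degree : ℕ∞) < (MvPowerSeries.monomial a (1 : k) * H₂).order := by
      refine lt_of_lt_of_le ?_ MvPowerSeries.le_order_mul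
      rw [ha, map_add, Nat.cast_add]
      exact (ENat.add_lt_add_iff_left (ENat.coe_ne_top _)).mpr h₂
    have e2 : ((a + b).degree : ℕ∞) < (H₁ * MvPowerSeries.monomial b (1 : k)).order := by
      refine lt_of_lt_of_le ?_ MvPowerSeries.le_order_mul
      rw [hb, map_add, Nat.cast_add]
      exact (ENat.add_lt_add_iff_right (ENat.coe_ne_top _)).mpr h₁
    have e3 : ((a + b).degree : ℕ∞) < (H₁ * H₂).order := by
      refine lt_of_lt_of_le ?_ MvPowerSeries.le_order_mul
      rw [map_add, Nat.cast_add]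
      exact lt_of_lt_of_le ((ENat.add_lt_add_iff_right (ENat.coe_ne_top _)).mpr h₁)
        (add_le_add le_rfl h₂.le)
    refine lt_of_lt_of_le ?_ MvPowerSeries.min_order_le_add
    refine lt_min e1 ?_
    refine lt_of_lt_of_le ?_ MvPowerSeries.min_order_le_add
    exact lt_min e2 e3

/-- `MonPlus` is stable under powers. [folklore] -/
theorem monPlus_pow {P : MvPowerSeries σ k} {a : σ →₀ ℕ} (hP : MonPlus P a) (m : ℕ) :
    MonPlus (P ^ m) (m • a) := by
  induction m with
  | zero => simpa using (monPlus_one (σ := σ) (k := k))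
  | succ m ih =>
    rw [pow_succ, succ_nsmul]
    exact monPlus_mul ih hP

/-- `MonPlus` is stable under the `Finsupp.prod` appearing in `MvPowerSeries.coeff_subst`.
[folklore] -/
theorem monPlus_finsuppProd {ι : Type*} (ψ : ι → MvPowerSeries σ k) (e : ι → σ →₀ ℕ)
    (hψ : ∀ i, MonPlus (ψ i) (e i)) (d : ι →₀ ℕ) :
    MonPlus (d.prod fun s m => ψ s ^ m) (d.sum fun s m => m • e s) := by
  classical
  induction d using Finsupp.induction with
  | zero => simpa using (monPlus_one (σ := σ) (k := k))
  | single_add i m d hi hm ih =>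
    rw [Finsupp.prod_add_index' (h := fun s m => ψ s ^ m) (fun _ => pow_zero _)
        (fun _ _ _ => pow_add _ _ _),
      Finsupp.sum_add_index' (h := fun s m => m • e s) (fun _ => zero_nsmul _)
        (fun a b₁ b₂ => add_nsmul (e a) b₁ b₂),
      Finsupp.prod_single_index (h := fun s m => ψ s ^ m) (pow_zero _),
      Finsupp.sum_single_index (h := fun s m => m • e s) (zero_nsmul _)]
    exact monPlus_mul (monPlus_pow (hψ i) m) ih

/-- Coefficients of degree `≤ |d|` of an `Xᵈ + h.o.t.` series. [folklore] -/
theorem coeff_of_monPlus [DecidableEq σ] {P : MvPowerSeries σ k} {d : σ →₀ ℕ} (hP : MonPlus P d)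
    (e : σ →₀ ℕ) (he : e.degree ≤ d.degree) :
    MvPowerSeries.coeff e P = if e = d then 1 else 0 := by
  obtain ⟨H, rfl, hH⟩ := hP
  rw [map_add, MvPowerSeries.coeff_monomial, MvPowerSeries.coeff_of_lt_order, add_zero]
  exact lt_of_le_of_lt (show (e.degree : ℕ∞) ≤ d.degree by exact_mod_cast he) hH

/-! ### tangent-to-identity substitutions are injective -/

variable {n : ℕ}

/-- `ψ i = X i + (order ≥ 2)`. [folklore] -/
def TangentId (ψ : Fin n → MvPowerSeries (Fin n) k) : Prop :=
  (∀ i, MvPowerSeries.constantCoeff (ψ i) = 0) ∧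
    ∀ i j, MvPowerSeries.coeff (Finsupp.single j 1) (ψ i) = if i = j then 1 else 0

/-- Each component of a tangent-to-identity substitution is `X i + h.o.t.`. [folklore] -/
theorem TangentId.monPlus {ψ : Fin n → MvPowerSeries (Fin n) k} (h : TangentId ψ) (i : Fin n) :
    MonPlus (ψ i) (Finsupp.single i 1) := by
  classical
  refine ⟨ψ i - MvPowerSeries.X i, by simp [MvPowerSeries.X_def], ?_⟩
  rw [Finsupp.degree_single, Nat.cast_one]
  have : (2 : ℕ∞) ≤ (ψ i - MvPowerSeries.X i).order := by
    rw [two_le_order_iff]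
    refine ⟨by simp [h.1 i, MvPowerSeries.constantCoeff_X], fun j => ?_⟩
    rw [map_sub, h.2 i j, MvPowerSeries.coeff_X]
    by_cases hij : i = j
    · subst hij; simp
    · have : ¬ (Finsupp.single j 1 : Fin n →₀ ℕ) = Finsupp.single i 1 := fun hh =>
        hij ((Finsupp.single_left_inj one_ne_zero).mp hh).symm
      simp [hij, this]
  exact lt_of_lt_of_le (by norm_num) this

/-- A tangent-to-identity substitution is substitutable. [folklore] -/
theorem TangentId.hasSubst {ψ : Fin n → MvPowerSeries (Fin n) k} (h : TangentId ψ) :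
    MvPowerSeries.HasSubst ψ :=
  MvPowerSeries.hasSubst_of_constantCoeff_zero h.1

/-- The lowest-order coefficients are unchanged by a tangent-to-identity substitution. [folklore] -/
theorem TangentId.coeff_subst_of_degree_le {ψ : Fin n → MvPowerSeries (Fin n) k} (h : TangentId ψ)
    (F : MvPowerSeries (Fin n) k) (e : Fin n →₀ ℕ) (he : (e.degree : ℕ∞) ≤ F.order) :
    MvPowerSeries.coeff e (MvPowerSeries.subst ψ F) = MvPowerSeries.coeff e F := by
  classical
  rw [MvPowerSeries.coeff_subst h.hasSubst]
  have key : ∀ d : Fin n →₀ ℕ, e.degree ≤ d.degree →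
      MvPowerSeries.coeff e (d.prod fun s m => ψ s ^ m) = if e = d then 1 else 0 := by
    intro d hd
    have hmp := monPlus_finsuppProd ψ (fun i => Finsupp.single i 1) h.monPlus d
    have hsum : (d.sum fun s m => m • Finsupp.single s 1) = d := by
      conv_rhs => rw [← Finsupp.sum_single d]
      apply Finsupp.sum_congr
      intro i _
      simp [Finsupp.smul_single]
    rw [hsum] at hmp
    exact coeff_of_monPlus hmp e hd
  rw [finsum_eq_single _ e]
  · rw [key e le_rfl, if_pos rfl, smul_eq_mul, mul_one]
  · intro d hde
    by_cases hlt : d.degree < e.degree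
    · rw [MvPowerSeries.coeff_of_lt_order (lt_of_lt_of_le (by exact_mod_cast hlt) he), zero_smul]
    · push Not at hlt
      rw [key d hlt, if_neg (Ne.symm hde), smul_zero]

/-- A tangent-to-identity substitution kills no nonzero series. [folklore] -/
theorem TangentId.subst_ne_zero {ψ : Fin n → MvPowerSeries (Fin n) k} (h : TangentId ψ)
    {F : MvPowerSeries (Fin n) k} (hF : F ≠ 0) : MvPowerSeries.subst ψ F ≠ 0 := by
  obtain ⟨e, he, hdeg⟩ :=
    MvPowerSeries.exists_coeff_ne_zero_and_order (MvPowerSeries.ne_zero_iff_order_finite.mp hF)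
  intro h0
  have := h.coeff_subst_of_degree_le F e hdeg.le
  rw [h0, map_zero] at this
  exact he this.symm

/-! ### linear substitutions -/

/-- The linear substitution `X i ↦ ∑ j, M i j • X j`. [folklore] -/
noncomputable def linSubst (M : Matrix (Fin n) (Fin n) k) : Fin n → MvPowerSeries (Fin n) k :=
  fun i => ∑ j, M i j • MvPowerSeries.X j

/-- A linear substitution is substitutable. [folklore] -/
theorem hasSubst_linSubst (M : Matrix (Fin n) (Fin n) k) : MvPowerSeries.HasSubst (linSubst M) :=
  MvPowerSeries.hasSubst_of_constantCoeff_zero fun i => by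
    simp [linSubst, map_sum, MvPowerSeries.constantCoeff_X]

/-- Substituting into a linear form. [folklore] -/
theorem subst_linSubst_apply {τ : Type*} {b : Fin n → MvPowerSeries τ k}
    (hb : MvPowerSeries.HasSubst b) (M : Matrix (Fin n) (Fin n) k) (i : Fin n) :
    MvPowerSeries.subst b (linSubst M i) = ∑ j, M i j • b j := by
  rw [← MvPowerSeries.coe_substAlgHom hb, linSubst, map_sum]
  refine Finset.sum_congr rfl fun j _ => ?_
  rw [map_smul, MvPowerSeries.substAlgHom_X]

/-- Linear substitutions compose like matrices (`M` first, then `N`, gives `M * N`).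
[folklore] -/
theorem subst_linSubst_linSubst (M N : Matrix (Fin n) (Fin n) k) (f : MvPowerSeries (Fin n) k) :
    MvPowerSeries.subst (linSubst N) (MvPowerSeries.subst (linSubst M) f) =
      MvPowerSeries.subst (linSubst (M * N)) f := by
  rw [MvPowerSeries.subst_comp_subst_apply (hasSubst_linSubst M) (hasSubst_linSubst N)]
  congr 1
  funext i
  rw [subst_linSubst_apply (hasSubst_linSubst N)]
  simp only [linSubst, Matrix.mul_apply, Finset.smul_sum, smul_smul, Finset.sum_smul]
  rw [Finset.sum_comm]

/-- The identity matrix gives the identity substitution. [folklore] -/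
theorem linSubst_one : linSubst (1 : Matrix (Fin n) (Fin n) k) = MvPowerSeries.X := by
  funext i
  simp [linSubst, Matrix.one_apply, Finset.sum_ite_eq]

/-- An invertible linear substitution is injective (it has the inverse linear substitution as a
left inverse). [folklore] -/
theorem subst_linSubst_injective {M : Matrix (Fin n) (Fin n) k} (hM : IsUnit M.det) :
    Function.Injective (MvPowerSeries.subst (linSubst M) :
      MvPowerSeries (Fin n) k → MvPowerSeries (Fin n) k) := by
  intro f g hfg
  have := congrArg (MvPowerSeries.subst (linSubst M⁻¹)) hfg
  rwa [subst_linSubst_linSubst, subst_linSubst_linSubst, Matrix.mul_nonsing_inv _ hM,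
    linSubst_one, MvPowerSeries.subst_self] at this

/-! ### general θ with invertible linear part -/

/-- The linear part of a substitution family. [folklore] -/
noncomputable def linMat (θ : Fin n → MvPowerSeries (Fin n) k) : Matrix (Fin n) (Fin n) k :=
  Matrix.of fun i j => MvPowerSeries.coeff (Finsupp.single j 1) (θ i)

/-- Normalisation `θ' i = ∑ j, (L⁻¹) i j • θ j`. [folklore] -/
noncomputable def normalize (θ : Fin n → MvPowerSeries (Fin n) k) : Fin n → MvPowerSeries (Fin n) k :=
  fun i => ∑ j, (linMat θ)⁻¹ i j • θ j

/-- The `L⁻¹`-normalisation of `θ` is tangent to the identity. [folklore] -/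
theorem tangentId_normalize {θ : Fin n → MvPowerSeries (Fin n) k}
    (h0 : ∀ i, MvPowerSeries.constantCoeff (θ i) = 0) (hdet : IsUnit (linMat θ).det) :
    TangentId (normalize θ) := by
  refine ⟨fun i => by simp [normalize, map_sum, h0], fun i j => ?_⟩
  have hmul := Matrix.nonsing_inv_mul (linMat θ) hdet
  have hij := congrFun (congrFun hmul i) j
  rw [Matrix.mul_apply, Matrix.one_apply] at hij
  simp only [normalize, map_sum, map_smul, smul_eq_mul]
  exact hij

/-- `θ = L · normalize θ`. [folklore] -/
theorem theta_eq_linSubst_normalize {θ : Fin n → MvPowerSeries (Fin n) k}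
    (hdet : IsUnit (linMat θ).det) (i : Fin n) :
    θ i = ∑ j, linMat θ i j • normalize θ j := by
  simp only [normalize, Finset.smul_sum, smul_smul]
  rw [Finset.sum_comm]
  have hmul := Matrix.mul_nonsing_inv (linMat θ) hdet
  have key : ∀ y, (∑ x, linMat θ i x * (linMat θ)⁻¹ x y) = if i = y then 1 else 0 := by
    intro y
    have := congrFun (congrFun hmul i) y
    rw [Matrix.mul_apply, Matrix.one_apply] at this
    exact this
  simp_rw [← Finset.sum_smul, key, ite_smul, one_smul, zero_smul, Finset.sum_ite_eq, Finset.mem_univ,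
    if_true]

/-- Factorisation `subst θ = subst (normalize θ) ∘ subst (linSubst L)`. [folklore] -/
theorem subst_eq_subst_normalize {θ : Fin n → MvPowerSeries (Fin n) k}
    (h0 : ∀ i, MvPowerSeries.constantCoeff (θ i) = 0) (hdet : IsUnit (linMat θ).det)
    (f : MvPowerSeries (Fin n) k) :
    MvPowerSeries.subst θ f =
      MvPowerSeries.subst (normalize θ) (MvPowerSeries.subst (linSubst (linMat θ)) f) := by
  rw [MvPowerSeries.subst_comp_subst_apply (hasSubst_linSubst _) (tangentId_normalize h0 hdet).hasSubst]
  congr 1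
  funext i
  rw [subst_linSubst_apply (tangentId_normalize h0 hdet).hasSubst]
  exact theta_eq_linSubst_normalize hdet i

/-- INJECTIVITY: a substitution with zero constant terms and invertible linear part kills no
nonzero series. [folklore] -/
theorem subst_ne_zero_of_isUnit_det {θ : Fin n → MvPowerSeries (Fin n) k}
    (h0 : ∀ i, MvPowerSeries.constantCoeff (θ i) = 0) (hdet : IsUnit (linMat θ).det)
    {f : MvPowerSeries (Fin n) k} (hf : f ≠ 0) : MvPowerSeries.subst θ f ≠ 0 := by
  rw [subst_eq_subst_normalize h0 hdet]
  refine (tangentId_normalize h0 hdet).subst_ne_zero ?_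
  intro h
  apply hf
  apply subst_linSubst_injective hdet
  rw [h, ← MvPowerSeries.coe_substAlgHom (hasSubst_linSubst _), map_zero]



end Literature.AlgebraicGeometry.Resolution.FormalCoordChange
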